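import Summits.BirchSwinnertonDyer.BirchSwinnertonDyer.Theses.AdditiveKolyvaginRoad
import HarnessLib

/-!
# Route `AdditiveKolyvaginRoad`, glue item `ManinGoodOddFrameAdditiveResplitGlue`
# (stmt-BirchSwinnertonDyer-20095): the three class loci cover every AKR frame

Cell `pub/bsd-wall` (D-0120, W-ALL lane 3, row 2), seat `bsd-wall-akr-p2` (prover). THEOREMS ONLY
(no definition, no named fact, no `sorry`); nothing is booked.

WHAT THE ITEM ASKS. The gen-2 resplit of the crux `ManinGoodOddFrameAdditive`
(stmt-BirchSwinnertonDyer-20136) has five BY-NAME inputs (Edixhoven ×2, Mazur, Abbes–Ullmo,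
Česnavičius), three content children — `ManinFrameOffExceptionClass` (`p ≥ 11`, the whole
`ℚ`-isogeny class off Edixhoven's exception), `ManinFrameIstarClass` (Kodaira type `Iₙ*` at `p`
throughout the class), `ManinFrameResidueClass` (the rest) — and this glue: children ⟹ parent.

PROOF = pure logic (the planner's `resplitGlue_holds`, rev 5 sketch; the vet refuter's candidate
`Frame.lean` on the item): case split on the two CLOSED class loci; on the complement the two
negations are pushed through the class quantifier to give exactly the residue hypothesis
`(p < 11 ∨ ∃ W' ∼ W on the exception) ∧ (∃ W' ∼ W with no Iₙ* fibre at p)`.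

References: [EdixhovenManin1991] Thm. 3 (the shape of the exception locus only; no mathematics is
used here).
-/

set_option autoImplicit false
-- the Theorems directory repeats the summit name (sibling precedent `SignedBaseChangeAssembly.lean`)
set_option linter.dupNamespace false

namespace Summit.BirchSwinnertonDyer.BirchSwinnertonDyer.Theorems.ManinGoodOddFrameAdditiveResplitGlue

open Summit.BirchSwinnertonDyer.BirchSwinnertonDyer.Theses.AdditiveKolyvaginRoad

/-- **`ManinGoodOddFrameAdditiveResplitGlue` (item stmt-BirchSwinnertonDyer-20095) — the route decl
BY NAME, unconditional**: `ManinFrameOffExceptionClass → ManinFrameIstarClass →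
ManinFrameResidueClass → ManinGoodOddFrameAdditive` (after the five by-name inputs), by a case split
on the `Iₙ*`-class locus and on the `p ≥ 11` off-exception class locus; the complement of both is
the residue locus verbatim. Pure logic. -/
theorem maninGoodOddFrameAdditiveResplitGlue_proof : ManinGoodOddFrameAdditiveResplitGlue := by
  intro h1 h2 h3 h4 h5 hOff hIst hRes hP W _ _ p _ _ h5p hadd hirr hr1
  by_cases hI : (∀ (W' : WeierstrassCurve ℚ) [W'.IsElliptic] [W'.IsGloballyMinimal],
      WeierstrassCurve.IsIsogenous W W' →
        ∃ (v : IsDedekindDomain.HeightOneSpectrum ℤ) (n : ℕ),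
          Rat.HeightOneSpectrum.natGenerator v = p ∧
            W'.kodairaSymbolAt v = Literature.NumberTheory.DiophantineGeometry.KodairaSymbol.Istar n)
  · -- the `Iₙ*` class locus
    exact hIst h3 h4 h5 hP W p h5p hadd hirr hI hr1
  · by_cases hE : 11 ≤ p ∧ (∀ (W' : WeierstrassCurve ℚ) [W'.IsElliptic] [W'.IsGloballyMinimal],
        WeierstrassCurve.IsIsogenous W W' →
          (¬ Summit.BirchSwinnertonDyer.Rank1Residual.Additive.TypeGOrd W' p ∨
            4 < padicValInt p W'.minimalDiscriminantInt))
    · -- `p ≥ 11` and the class off Edixhoven's exception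
      exact hOff h1 h2 hP W p hE.1 hadd hirr (fun W' _ _ hiso => hE.2 W' hiso) hr1
    · -- the residue: both negations, pushed through the class quantifier
      refine hRes hP W p h5p hadd hirr ⟨?_, ?_⟩ hr1
      · by_cases h11 : 11 ≤ p
        · right
          by_contra hc
          apply hE
          refine ⟨h11, fun W' _ _ hiso => ?_⟩
          by_contra hc'
          push Not at hc'
          exact hc ⟨W', ‹_›, ‹_›, hiso, hc'.1, hc'.2⟩
        · left
          omega
      · by_contra hc
        apply hI
        intro W' _ _ hiso
        by_contra hc'
        push Not at hc'
        exact hc ⟨W', ‹_›, ‹_›, hiso, fun v n hv => hc' v n hv⟩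

end Summit.BirchSwinnertonDyer.BirchSwinnertonDyer.Theorems.ManinGoodOddFrameAdditiveResplitGlue
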